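import Literature.Computability.AlgebraicComplexity.DDS21BorderDepthThree
import Literature.Computability.AlgebraicComplexity.DepthThreeChasmAlgebra
import Mathlib.Algebra.MvPolynomial.PDeriv
import Mathlib.Algebra.MvPolynomial.Equiv
import Mathlib.Data.Nat.Choose.Sum
import HarnessLib

/-!
# Dutta–Dwivedi–Saxena 2021, §2.3: the calculus of depth-3 diagonal circuits (`Σ∧Σ`) with sizes

Theorem-only companion (cell `val-lit`, row X2-DDS21, brick B2 of the sizing memo
`HOME/np/t20g7-DDS21-thm32-thm51-sizing.md`) of `DDS21BorderDepthThree.lean`, whose set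
`DDS2021.swsClass K n t e` ("`Σ∧Σ` with top fan-in `≤ t` and exponents `≤ e`":
`f = ∑_{i<t} c_i · ℓ_i^{e_i}`, `ℓ_i` affine, `e_i ≤ e`) is used BY NAME. Source: P. Dutta,
P. Dwivedi, N. Saxena, *Demystifying the border of depth-3 algebraic circuits*, FOCS 2021, FULL
VERSION (`paper:galaxy-pdf-7641649743695546420`, SIAM-style printed line numbers `Lnnn`), §2.3
"Properties of depth-3 diagonal circuits", p0020 L537 – p0022 L603 [DuttaDwivediSaxena2022].

SIZE CONVENTION. The printed size of a `Σ∧Σ` circuit `∑_{i<t} c_i ℓ_i^{e_i}` is `Θ(∑_i (e_i + n))`,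
so `t ≤ size` and `size ≤ t · (e + n)`; every lemma below books the pair (top fan-in, exponent
bound) explicitly, from which the printed `O(·)` bounds follow.

## What is printed and what is proved (every statement PROVED; no named facts, no definitions)

* §1 (folklore closure, used tacitly throughout §2.3/§3 of the source): `swsClass` is monotone in
  `(t, e)`, contains `0`, constants and scalar multiples of powers of affine forms, and is closed
  under scalar multiplication, negation, `+` (fan-ins add), finite sums and affine substitutions
  of the variables (`mem_swsClass_of_fintype`, `swsClass_mono`, `add_mem_swsClass`,
  `sum_mem_swsClass`, `aeval_affine_mem_swsClass`, …); members have total degree `≤ e`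
  (`totalDegree_le_of_mem_swsClass`).
* §2 **Lemma 2.11 at `k = 2` (Waring identity for a product of two powers)** (p0020 L542–547:
  "`M = x_1^{b_1} ⋯ x_k^{b_k}` … `M = ∑ γ · (x_1 + ε(2)x_2 + ⋯)^d` … `∏_{i≥2}(b_i+1)` many scalars";
  Remark: "For fields other than `ℂ` we can go to a small extension"). PROVED here in the
  interpolation form that needs no roots of unity, over any field of characteristic zero:
  `y^a z^b = ∑_{u=0}^{a+b} w_u (y + u·z)^{a+b}` in every commutative `K`-algebra
  (`exists_waringWeights_two`; `a+b+1` powers instead of the printed `b+1` — harmless for every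
  `O(·)` bound of the source, which only uses "polynomial in the degrees, multilinear in the
  sizes"), via the tree's inverse-Vandermonde weights `DepthThreeChasm.exists_dual_weights`.
* §3 **Lemma 2.12 (`Σ∧Σ` closed under multiplication)** (p0020 L549–555: "`f_1 ⋯ f_k` has `Σ∧Σ`
  circuit of size `O((d_2+1)⋯(d_k+1) · s_1⋯s_k)`"): `mul_mem_swsClass` — `f ∈ Σ∧Σ(t₁,e₁)`,
  `g ∈ Σ∧Σ(t₂,e₂)` ⇒ `f·g ∈ Σ∧Σ(t₁·t₂·(e₁+e₂+1), e₁+e₂)` — and the `k`-fold / power corollaries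
  `prod_mem_swsClass`, `pow_mem_swsClass` with closed-form budgets.
* §4 **Lemma 2.15 (`Σ∧Σ` differentiation)** (p0021 L578–583): `pderiv_mem_swsClass` —
  `∂_{x_m} f ∈ Σ∧Σ(t, e−1)` (proved directly from `∂ ℓ^p = p (∂ℓ) ℓ^{p−1}`; the print's `O(s d²)`
  via coefficient extraction is weaker).
* §5 **Lemma 2.14 (`Σ∧Σ` coefficient extraction)** (p0021 L571–576: "Interpolate using
  `(d+1)`-many distinct points … `f_i` has a `Σ∧Σ` circuit of size `O(sd)`"): with the
  distinguished variable `x_0` of `Fin (n+1)` and Mathlib's `finSuccEquiv`,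
  `coeff_finSuccEquiv_mem_swsClass` — every coefficient of `f` as a polynomial in `x_0` lies in
  `Σ∧Σ((e+1)·t, e)` over the remaining variables (nodes `0, …, e`, characteristic zero); the
  interpolation step itself, `factorial_mul_coeff_eq_sum_eval`, is stated over any commutative
  `K`-algebra.
* §6 **Lemma 2.17 for `Σ∧Σ` (sum of products of univariates)** (p0022 L593–603: "convert `∧Σ`
  into `ΣΠΣ^{∧}` (i.e. sum-of-product-of-univariates) which is subsumed by ARO … top fan-in
  `O(sne)` and individual degree at most `D`"), via the tree's Saxena duality trick
  `DepthThreeChasm.duality` (Lemma 2.16): `exists_sum_prod_univariate_of_mem_swsClass` — every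
  `f ∈ Σ∧Σ(t,e)` is a sum of `t·((n+1)e+1)` terms `κ · ∏_{m<n} g_m(x_m)` with univariate `g_m`
  of degree `≤ e` (characteristic zero).
  (The plain containment `Σ∧Σ ⊆ ABP` in the tree's `DDS2021.UABPComputes` currency needs no
  duality and is `DDS2021.uabpComputes_of_mem_swsClass` of `UABPToolkit.lean` (val-lit t18); the
  sum-of-products-of-univariates form here is the READ-ONCE structure that the border argument of
  the source's Lemmas 2.22/2.23 — Nisan's coefficient-dimension characterisation — consumes.)

Deviations from print, all disclosed above: interpolation nodes `0,1,…,d` instead of roots of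
unity (so `[CharZero K]` where the source says "`ℂ`, or a small extension"); Lemma 2.15 proved
directly; budgets are explicit pairs instead of `O(·)`. COEFFICIENT DOMAIN: the tree's `swsClass`
is over a FIELD `K`; the source's §3 (Def. 3.1, `Gen(k,s)`) runs the same calculus over the rings
`R_j = 𝔽(ε)[z]/(z^{d_j})` — for that use the representation-level identities here
(`exists_waringWeights_two`, `factorial_mul_coeff_eq_sum_eval`) and the tree's
`DepthThreeChasm.duality` are stated over an arbitrary commutative `K`-algebra, while the
set-level closure lemmas would have to be re-instantiated on a ring-coefficient class (not defined
here: no new definitions in this file). Not here: the bloated model `Σ∧Σ/Σ∧Σ` (Lemma 2.13 is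
`mul_mem_swsClass` + `add_mem_swsClass` on numerators/denominators and needs no new statement),
`Σ∧Σ∧`, ARO width (Lemmas 2.9/2.10) and the de-bordering Lemma 2.23 — brick B1/B4 territory of
the memo.

Honest framing: closure bookkeeping for a restricted circuit class, banked toward the x-rows
`DDS2021_thm_3_2` / `DDS2021_thm_5_1`; it discharges nothing by itself; `VP ≠ VNP` is NOT proved
and nothing here bears on it.

## References

* [DuttaDwivediSaxena2022] P. Dutta, P. Dwivedi, N. Saxena, *Demystifying the border of depth-3
  algebraic circuits*, FOCS 2021; full version §2.3, Lemmas 2.11, 2.12, 2.14, 2.15, 2.16, 2.17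
  (p0020 L537 – p0022 L603).
* [CarliniCatalisanoGeramita2012] E. Carlini, M. V. Catalisano, A. V. Geramita, *The solution to
  the Waring problem for monomials and the sum of coprime monomials*, J. Algebra 370 (2012),
  Prop. 4.3 (the source's [33] for Lemma 2.11; attribution only).
* [GuptaKamathKayalSaptharishi2016] A. Gupta, P. Kamath, N. Kayal, R. Saptharishi, *Arithmetic
  circuits: a chasm at depth 3*, SIAM J. Comput. 45 (2016), Lemma 4.6 (Saxena's duality trick; tree
  `DepthThreeChasm.duality`, `DepthThreeChasm.exists_dual_weights`).
-/

noncomputable section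

open MvPolynomial
open scoped BigOperators

namespace Literature.Computability.AlgebraicComplexity

namespace DDS2021

universe u

variable {K : Type*} [Field K] {n : ℕ}

/-! ## §1 Folklore closure properties of `Σ∧Σ(t, e)` -/

section Closure

/-- **Re-indexing**: a sum of `c_i · ℓ_i^{e_i}` (`ℓ_i` affine, `e_i ≤ e`) over ANY finite index
type with at most `t` elements is in `Σ∧Σ(t, e)` (pad with zero coefficients along an embedding
into `Fin t`). [cite: DuttaDwivediSaxena2022, §2.3 (full version p0020 L537–540)] -/
theorem mem_swsClass_of_fintype {ι : Type*} [Fintype ι] {t e : ℕ} (hι : Fintype.card ι ≤ t)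
    (c : ι → K) (α : ι → Option (Fin n) → K) (ex : ι → ℕ) (hex : ∀ i, ex i ≤ e)
    {f : MvPolynomial (Fin n) K}
    (hf : f = ∑ i, C (c i) * (C (α i none) + ∑ m, C (α i (some m)) * X m) ^ ex i) :
    f ∈ swsClass K n t e := by
  classical
  have hcard : Fintype.card ι ≤ Fintype.card (Fin t) := by rwa [Fintype.card_fin]
  obtain ⟨φ⟩ := Function.Embedding.nonempty_of_card_le hcard
  refine ⟨Function.extend φ c 0, Function.extend φ α 0, Function.extend φ ex 0, ?_, ?_⟩
  · intro j
    by_cases hj : ∃ i, φ i = j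
    · obtain ⟨i, rfl⟩ := hj
      rw [φ.injective.extend_apply]
      exact hex i
    · rw [Function.extend_apply' _ _ _ hj]
      exact Nat.zero_le _
  · rw [hf]
    -- the sum over `Fin t` is supported on the image of `φ`
    have hsupp : ∀ j ∈ (Finset.univ : Finset (Fin t)), j ∉ Finset.univ.map φ →
        C (Function.extend φ c 0 j) *
          (C (Function.extend φ α 0 j none) +
            ∑ m, C (Function.extend φ α 0 j (some m)) * X m) ^ Function.extend φ ex 0 j = 0 := by
      intro j _ hj
      have hj' : ¬ ∃ i, φ i = j := by
        rintro ⟨i, rfl⟩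
        exact hj (Finset.mem_map_of_mem φ (Finset.mem_univ i))
      rw [Function.extend_apply' _ _ _ hj', Pi.zero_apply, C_0, zero_mul]
    rw [← Finset.sum_subset (Finset.subset_univ (Finset.univ.map φ)) hsupp, Finset.sum_map]
    refine Finset.sum_congr rfl fun i _ => ?_
    simp only [φ.injective.extend_apply]

/-- **Monotonicity** of the budgets. [cite: DuttaDwivediSaxena2022, §2.3 (full version p0020 L537–540)] -/
theorem swsClass_mono {t t' e e' : ℕ} (ht : t ≤ t') (he : e ≤ e') :
    swsClass K n t e ⊆ swsClass K n t' e' := by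
  rintro f ⟨c, α, ex, hex, hf⟩
  exact mem_swsClass_of_fintype (by rwa [Fintype.card_fin]) c α ex (fun i => (hex i).trans he) hf

/-- `0 ∈ Σ∧Σ(t, e)` (the empty circuit). [cite: DuttaDwivediSaxena2022, §2.3 (full version p0020 L537–540)] -/
theorem zero_mem_swsClass (t e : ℕ) : (0 : MvPolynomial (Fin n) K) ∈ swsClass K n t e :=
  mem_swsClass_of_fintype (ι := Fin 0) (by simp) (fun _ => 0) (fun _ _ => 0) (fun _ => 0)
    (fun _ => Nat.zero_le _) (by simp)

/-- A scalar multiple of one power of an affine form, `c · ℓ^k` with `k ≤ e`, is in `Σ∧Σ(t, e)`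
for every `t ≥ 1`. [cite: DuttaDwivediSaxena2022, §2.3 (full version p0020 L537–540)] -/
theorem C_mul_affinePow_mem_swsClass {t e k : ℕ} (ht : 1 ≤ t) (hk : k ≤ e) (c : K)
    (a : Option (Fin n) → K) :
    C c * (C (a none) + ∑ m, C (a (some m)) * X m) ^ k ∈ swsClass K n t e :=
  mem_swsClass_of_fintype (ι := Fin 1) (by simpa using ht) (fun _ => c) (fun _ => a) (fun _ => k)
    (fun _ => hk) (by simp)

/-- A power of an affine form `ℓ^k`, `k ≤ e`, is in `Σ∧Σ(t, e)` for `t ≥ 1`.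
[cite: DuttaDwivediSaxena2022, §2.3 (full version p0020 L537–540)] -/
theorem affinePow_mem_swsClass {t e k : ℕ} (ht : 1 ≤ t) (hk : k ≤ e) (a : Option (Fin n) → K) :
    (C (a none) + ∑ m, C (a (some m)) * X m) ^ k ∈ swsClass K n t e := by
  have h := C_mul_affinePow_mem_swsClass (n := n) ht hk (1 : K) a
  rwa [C_1, one_mul] at h

/-- Constants are in `Σ∧Σ(t, e)` for `t ≥ 1` (`c = c · ℓ^0`).
[cite: DuttaDwivediSaxena2022, §2.3 (full version p0020 L537–540)] -/
theorem C_mem_swsClass {t e : ℕ} (ht : 1 ≤ t) (c : K) :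
    (C c : MvPolynomial (Fin n) K) ∈ swsClass K n t e := by
  have h := C_mul_affinePow_mem_swsClass (n := n) (k := 0) ht (Nat.zero_le e) c (fun _ => 0)
  rwa [pow_zero, mul_one] at h

/-- A variable is in `Σ∧Σ(t, e)` for `t, e ≥ 1` (`x_m = ℓ^1` with `ℓ = x_m`).
[cite: DuttaDwivediSaxena2022, §2.3 (full version p0020 L537–540)] -/
theorem X_mem_swsClass {t e : ℕ} (ht : 1 ≤ t) (he : 1 ≤ e) (m : Fin n) :
    (X m : MvPolynomial (Fin n) K) ∈ swsClass K n t e := by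
  classical
  have h := affinePow_mem_swsClass (n := n) (k := 1) ht he
    (fun o => if o = some m then (1 : K) else 0)
  simp only [pow_one, reduceCtorEq, ite_false, C_0, zero_add, Option.some.injEq] at h
  convert h using 1
  rw [Finset.sum_eq_single m]
  · simp
  · intro j _ hj
    simp [hj]
  · intro hm
    exact absurd (Finset.mem_univ m) hm

/-- **Scalars**: `c · f ∈ Σ∧Σ(t, e)` whenever `f ∈ Σ∧Σ(t, e)`.
[cite: DuttaDwivediSaxena2022, §2.3 (full version p0020 L537–540)] -/
theorem C_mul_mem_swsClass {t e : ℕ} (c : K) {f : MvPolynomial (Fin n) K}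
    (hf : f ∈ swsClass K n t e) : C c * f ∈ swsClass K n t e := by
  obtain ⟨c', α, ex, hex, hf⟩ := hf
  refine ⟨fun i => c * c' i, α, ex, hex, ?_⟩
  rw [hf, Finset.mul_sum]
  refine Finset.sum_congr rfl fun i _ => ?_
  rw [C_mul, mul_assoc]

/-- **Negation**. [cite: DuttaDwivediSaxena2022, §2.3 (full version p0020 L537–540)] -/
theorem neg_mem_swsClass {t e : ℕ} {f : MvPolynomial (Fin n) K} (hf : f ∈ swsClass K n t e) :
    -f ∈ swsClass K n t e := by
  have h := C_mul_mem_swsClass (-1 : K) hf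
  rwa [C_neg, C_1, neg_one_mul] at h

/-- **Addition**: fan-ins add, exponent bounds take the maximum.
[cite: DuttaDwivediSaxena2022, §2.3 (full version p0021 L566: "Trivially, `Σ∧Σ` is closed under addition")] -/
theorem add_mem_swsClass {t₁ t₂ e₁ e₂ : ℕ} {f g : MvPolynomial (Fin n) K}
    (hf : f ∈ swsClass K n t₁ e₁) (hg : g ∈ swsClass K n t₂ e₂) :
    f + g ∈ swsClass K n (t₁ + t₂) (max e₁ e₂) := by
  obtain ⟨c, α, ex, hex, hf⟩ := hf
  obtain ⟨c', α', ex', hex', hg⟩ := hg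
  refine mem_swsClass_of_fintype (ι := Fin t₁ ⊕ Fin t₂) (by simp) (Sum.elim c c')
    (Sum.elim α α') (Sum.elim ex ex') ?_ ?_
  · rintro (i | i)
    · exact (hex i).trans (le_max_left _ _)
    · exact (hex' i).trans (le_max_right _ _)
  · rw [hf, hg, Fintype.sum_sum_type]
    simp only [Sum.elim_inl, Sum.elim_inr]

/-- **Addition**, same budgets. [cite: DuttaDwivediSaxena2022, §2.3 (full version p0021 L566)] -/
theorem add_mem_swsClass' {t₁ t₂ e : ℕ} {f g : MvPolynomial (Fin n) K}
    (hf : f ∈ swsClass K n t₁ e) (hg : g ∈ swsClass K n t₂ e) :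
    f + g ∈ swsClass K n (t₁ + t₂) e := by
  have h := add_mem_swsClass hf hg
  rwa [max_self] at h

/-- **Subtraction**. [cite: DuttaDwivediSaxena2022, §2.3 (full version p0021 L566)] -/
theorem sub_mem_swsClass {t₁ t₂ e : ℕ} {f g : MvPolynomial (Fin n) K}
    (hf : f ∈ swsClass K n t₁ e) (hg : g ∈ swsClass K n t₂ e) :
    f - g ∈ swsClass K n (t₁ + t₂) e := by
  rw [sub_eq_add_neg]
  exact add_mem_swsClass' hf (neg_mem_swsClass hg)

/-- **Finite sums**: `∑_{i ∈ s} f_i ∈ Σ∧Σ(#s · t, e)` when every `f_i ∈ Σ∧Σ(t, e)`.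
[cite: DuttaDwivediSaxena2022, §2.3 (full version p0021 L566)] -/
theorem sum_mem_swsClass {ι : Type*} {t e : ℕ} (s : Finset ι) (f : ι → MvPolynomial (Fin n) K)
    (hf : ∀ i ∈ s, f i ∈ swsClass K n t e) :
    ∑ i ∈ s, f i ∈ swsClass K n (s.card * t) e := by
  classical
  induction s using Finset.induction_on with
  | empty => simpa using zero_mem_swsClass (n := n) (K := K) 0 e
  | @insert a s ha ih =>
    rw [Finset.sum_insert ha, Finset.card_insert_of_notMem ha, add_mul, one_mul, add_comm (s.card * t)]
    exact add_mem_swsClass' (hf a (Finset.mem_insert_self a s))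
      (ih fun i hi => hf i (Finset.mem_insert_of_mem hi))

/-- **Finite sums over a `Fintype`**. [cite: DuttaDwivediSaxena2022, §2.3 (full version p0021 L566)] -/
theorem sum_univ_mem_swsClass {ι : Type*} [Fintype ι] {t e : ℕ} (f : ι → MvPolynomial (Fin n) K)
    (hf : ∀ i, f i ∈ swsClass K n t e) :
    ∑ i, f i ∈ swsClass K n (Fintype.card ι * t) e :=
  sum_mem_swsClass Finset.univ f fun i _ => hf i

/-- An affine form has total degree `≤ 1`. [folklore] -/
private theorem totalDegree_affine_le (a : Option (Fin n) → K) :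
    (C (a none) + ∑ m, C (a (some m)) * X m : MvPolynomial (Fin n) K).totalDegree ≤ 1 := by
  refine (totalDegree_add _ _).trans (max_le (by rw [totalDegree_C]; exact Nat.zero_le _) ?_)
  refine totalDegree_finsetSum_le fun m _ => (totalDegree_mul _ _).trans ?_
  rw [totalDegree_C, zero_add, totalDegree_X]

/-- **Syntactic degree bound**: every member of `Σ∧Σ(t, e)` has total degree `≤ e` ("of syntactic
degree `≤ d_i`", p0020 L549–550). [cite: DuttaDwivediSaxena2022, Lemma 2.12 (full version p0020 L549–550)] -/
theorem totalDegree_le_of_mem_swsClass {t e : ℕ} {f : MvPolynomial (Fin n) K}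
    (hf : f ∈ swsClass K n t e) : f.totalDegree ≤ e := by
  obtain ⟨c, α, ex, hex, rfl⟩ := hf
  refine totalDegree_finsetSum_le fun i _ => (totalDegree_mul _ _).trans ?_
  rw [totalDegree_C, zero_add]
  refine (totalDegree_pow _ _).trans ?_
  calc ex i * (C (α i none) + ∑ m, C (α i (some m)) * X m).totalDegree
      ≤ ex i * 1 := Nat.mul_le_mul_left _ (totalDegree_affine_le (α i))
    _ ≤ e := by rw [mul_one]; exact hex i

/-- An affine substitution `x_m ↦ b_m,∅ + ∑_j b_m,j y_j` maps an affine form in `x` to the affine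
form in `y` with constant term `a_∅ + ∑_m a_m b_m,∅` and `y_j`-coefficient `∑_m a_m b_m,j`.
[folklore] -/
private theorem aeval_affine_affine {n' : ℕ} (b : Fin n → Option (Fin n') → K) (a : Option (Fin n) → K) :
    aeval (fun m : Fin n => (C (b m none) + ∑ j, C (b m (some j)) * X j : MvPolynomial (Fin n') K))
        (C (a none) + ∑ m, C (a (some m)) * X m) =
      C (a none + ∑ m, a (some m) * b m none) +
        ∑ j, C (∑ m, a (some m) * b m (some j)) * X j := by
  simp only [map_add, map_sum, map_mul, aeval_C, aeval_X, algebraMap_eq, mul_add, Finset.mul_sum,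
    Finset.sum_add_distrib, Finset.sum_mul, mul_assoc, add_assoc]
  congr 2
  exact Finset.sum_comm

/-- **Affine substitutions** (e.g. the source's `Φ : x_i ↦ z·x_i + α_i` at a fixed scalar `z`, or a
shift `x ↦ x + α`) map `Σ∧Σ(t, e)` in `x_0,…,x_{n-1}` into `Σ∧Σ(t, e)` in the new variables, with
the same budgets. [cite: DuttaDwivediSaxena2022, §3 proof of Thm. 3.2, "Φ homomorphism" (full version p0028 L751–757)] -/
theorem aeval_affine_mem_swsClass {n' t e : ℕ} (b : Fin n → Option (Fin n') → K)
    {f : MvPolynomial (Fin n) K} (hf : f ∈ swsClass K n t e) :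
    aeval (fun m : Fin n => (C (b m none) + ∑ j, C (b m (some j)) * X j : MvPolynomial (Fin n') K))
      f ∈ swsClass K n' t e := by
  obtain ⟨c, α, ex, hex, rfl⟩ := hf
  rw [map_sum]
  refine mem_swsClass_of_fintype (ι := Fin t) (by simp) c
    (fun i o => Option.elim o (α i none + ∑ m, α i (some m) * b m none)
      fun j => ∑ m, α i (some m) * b m (some j)) ex hex ?_
  refine Finset.sum_congr rfl fun i _ => ?_
  rw [map_mul, map_pow, aeval_C, algebraMap_eq, aeval_affine_affine]
  rfl

end Closure

/-! ## §2 Lemma 2.11 at `k = 2`: a product of two powers as a sum of `a + b + 1` powers -/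

section Waring

/-- **DDS21 Lemma 2.11 (Waring identity for a monomial), two factors, interpolation form.** Over a
field `K` of characteristic zero there are weights `w_0, …, w_{a+b}` with
`y^a · z^b = ∑_{u=0}^{a+b} w_u · (y + u·z)^{a+b}` for all `y, z` in every commutative `K`-algebra
(printed with `(b+1)`-th roots of unity and `b + 1` summands over `ℂ`; here the nodes are
`0, 1, …, a+b` and the weights are `β_u / ((a+b choose a) · b!)` for the inverse-Vandermonde row
`β` of `DepthThreeChasm.exists_dual_weights` extracting the coefficient of `z^b`).
[cite: DuttaDwivediSaxena2022, Lemma 2.11 (full version p0020 L542–547)] -/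
theorem exists_waringWeights_two [CharZero K] (a b : ℕ) :
    ∃ w : Fin (a + b + 1) → K, ∀ (R : Type u) [CommRing R] [Algebra K R] (y z : R),
      y ^ a * z ^ b =
        ∑ u : Fin (a + b + 1), algebraMap K R (w u) * (y + ((u : ℕ) : R) * z) ^ (a + b) := by
  obtain ⟨β, hβ⟩ := DepthThreeChasm.exists_dual_weights (K := K) (a + b) b
  set κ : K := (((a + b).choose a : ℕ) : K) * ((b.factorial : ℕ) : K) with hκ
  have hκ0 : κ ≠ 0 := by
    refine mul_ne_zero ?_ ?_
    · exact_mod_cast (Nat.choose_pos (Nat.le_add_right a b)).ne'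
    · exact_mod_cast (Nat.factorial_pos b).ne'
  refine ⟨fun u => κ⁻¹ * β u, fun R _ _ y z => ?_⟩
  -- expand every power by the binomial theorem and exchange the sums
  have hexp : ∀ u : Fin (a + b + 1),
      (y + ((u : ℕ) : R) * z) ^ (a + b) =
        ∑ k ∈ Finset.range (a + b + 1),
          algebraMap K R (((u : ℕ) : K) ^ (a + b - k)) *
            (y ^ k * z ^ (a + b - k) * (((a + b).choose k : ℕ) : R)) := by
    intro u
    rw [add_pow]
    refine Finset.sum_congr rfl fun k _ => ?_
    rw [mul_pow, map_pow, map_natCast]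
    ring
  simp_rw [hexp, Finset.mul_sum]
  rw [Finset.sum_comm]
  -- collect the weights against the powers of the nodes
  have hinner : ∀ k ∈ Finset.range (a + b + 1),
      ∑ u : Fin (a + b + 1), algebraMap K R (κ⁻¹ * β u) *
          (algebraMap K R (((u : ℕ) : K) ^ (a + b - k)) *
            (y ^ k * z ^ (a + b - k) * (((a + b).choose k : ℕ) : R))) =
        algebraMap K R (κ⁻¹ * ∑ u : Fin (a + b + 1), β u * ((u : ℕ) : K) ^ (a + b - k)) *
          (y ^ k * z ^ (a + b - k) * (((a + b).choose k : ℕ) : R)) := by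
    intro k _
    rw [Finset.mul_sum, map_sum, Finset.sum_mul]
    refine Finset.sum_congr rfl fun u _ => ?_
    simp only [map_mul]
    ring
  rw [Finset.sum_congr rfl hinner]
  -- only `k = a` survives
  have hval : ∀ k ∈ Finset.range (a + b + 1),
      ∑ u : Fin (a + b + 1), β u * ((u : ℕ) : K) ^ (a + b - k) =
        if a + b - k = b then ((b.factorial : ℕ) : K) else 0 := by
    intro k hk
    have hlt : a + b - k < a + b + 1 := Nat.lt_succ_of_le (Nat.sub_le _ _)
    exact hβ ⟨a + b - k, hlt⟩
  have hc0 : (((a + b).choose a : ℕ) : K) ≠ 0 := by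
    exact_mod_cast (Nat.choose_pos (Nat.le_add_right a b)).ne'
  have hb0 : ((b.factorial : ℕ) : K) ≠ 0 := by exact_mod_cast (Nat.factorial_pos b).ne'
  rw [Finset.sum_eq_single a]
  · rw [hval a (Finset.mem_range.2 (by omega)), if_pos (by omega), hκ]
    have : (((a + b).choose a : ℕ) : R) = algebraMap K R (((a + b).choose a : ℕ) : K) := by
      rw [map_natCast]
    rw [show a + b - a = b from Nat.add_sub_cancel_left a b, this]
    rw [mul_comm (y ^ a * z ^ b) _, ← mul_assoc, ← map_mul]
    rw [show ((((a + b).choose a : ℕ) : K) * ((b.factorial : ℕ) : K))⁻¹ * ((b.factorial : ℕ) : K) *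
        (((a + b).choose a : ℕ) : K) = 1 by field_simp]
    rw [map_one, one_mul]
  · intro k hk hka
    rw [hval k hk, if_neg, mul_zero, map_zero, zero_mul]
    have := Finset.mem_range.1 hk
    omega
  · intro ha
    exact absurd (Finset.mem_range.2 (by omega)) ha

/-- **A product of two (scaled) powers of affine forms is in `Σ∧Σ(a+b+1, a+b)`**: the affine
forms `ℓ + u·ℓ'` have coefficient vectors `α + u·α'`.
[cite: DuttaDwivediSaxena2022, Lemma 2.11 and Lemma 2.12 (full version p0020 L542–555)] -/
theorem affinePow_mul_affinePow_mem_swsClass [CharZero K] (c c' : K)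
    (α α' : Option (Fin n) → K) (a b : ℕ) :
    C c * (C (α none) + ∑ m, C (α (some m)) * X m) ^ a *
        (C c' * (C (α' none) + ∑ m, C (α' (some m)) * X m) ^ b) ∈
      swsClass K n (a + b + 1) (a + b) := by
  obtain ⟨w, hw⟩ := exists_waringWeights_two (K := K) a b
  set ℓ : MvPolynomial (Fin n) K := C (α none) + ∑ m, C (α (some m)) * X m with hℓ
  set ℓ' : MvPolynomial (Fin n) K := C (α' none) + ∑ m, C (α' (some m)) * X m with hℓ'
  have hprod := hw (MvPolynomial (Fin n) K) ℓ ℓ'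
  refine mem_swsClass_of_fintype (ι := Fin (a + b + 1)) (by simp)
    (fun u => c * c' * w u) (fun u o => α o + ((u : ℕ) : K) * α' o) (fun _ => a + b)
    (fun _ => le_rfl) ?_
  calc C c * ℓ ^ a * (C c' * ℓ' ^ b)
      = C (c * c') * (ℓ ^ a * ℓ' ^ b) := by rw [C_mul]; ring
    _ = C (c * c') * ∑ u : Fin (a + b + 1),
          algebraMap K (MvPolynomial (Fin n) K) (w u) * (ℓ + ((u : ℕ) : MvPolynomial (Fin n) K) * ℓ') ^ (a + b) := by
        rw [hprod]
    _ = ∑ u : Fin (a + b + 1), C (c * c' * w u) *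
          (C (α none + ((u : ℕ) : K) * α' none) +
            ∑ m, C (α (some m) + ((u : ℕ) : K) * α' (some m)) * X m) ^ (a + b) := by
        rw [Finset.mul_sum]
        refine Finset.sum_congr rfl fun u _ => ?_
        rw [MvPolynomial.algebraMap_eq, ← mul_assoc, ← C_mul]
        congr 1
        rw [hℓ, hℓ', mul_add, Finset.mul_sum, add_add_add_comm, ← Finset.sum_add_distrib]
        have h0 : C (α none) + ((u : ℕ) : MvPolynomial (Fin n) K) * C (α' none) =
            C (α none + ((u : ℕ) : K) * α' none) := by
          rw [C_add, C_mul, map_natCast]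
        rw [h0]
        congr 2
        refine Finset.sum_congr rfl fun m _ => ?_
        rw [C_add, C_mul, map_natCast]
        ring

end Waring

/-! ## §3 Lemma 2.12: `Σ∧Σ` is closed under multiplication -/

section Mul

/-- **DDS21 Lemma 2.12 (`Σ∧Σ` closed under multiplication), two factors, with budgets**:
`f ∈ Σ∧Σ(t₁, e₁)`, `g ∈ Σ∧Σ(t₂, e₂)` ⇒ `f · g ∈ Σ∧Σ(t₁ · t₂ · (e₁ + e₂ + 1), e₁ + e₂)` (print:
"size `O((d_2 + 1) · s_1 s_2)`"; expand and apply Lemma 2.11 to each of the `t₁ t₂` products of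
two powers). Characteristic zero (interpolation nodes `0, …, e₁ + e₂`).
[cite: DuttaDwivediSaxena2022, Lemma 2.12 (full version p0020 L549–555)] -/
theorem mul_mem_swsClass [CharZero K] {t₁ t₂ e₁ e₂ : ℕ} {f g : MvPolynomial (Fin n) K}
    (hf : f ∈ swsClass K n t₁ e₁) (hg : g ∈ swsClass K n t₂ e₂) :
    f * g ∈ swsClass K n (t₁ * t₂ * (e₁ + e₂ + 1)) (e₁ + e₂) := by
  obtain ⟨c, α, ex, hex, rfl⟩ := hf
  obtain ⟨c', α', ex', hex', rfl⟩ := hg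
  rw [Finset.sum_mul_sum, ← Finset.sum_product']
  have hcard : (Finset.univ ×ˢ Finset.univ : Finset (Fin t₁ × Fin t₂)).card * (e₁ + e₂ + 1) =
      t₁ * t₂ * (e₁ + e₂ + 1) := by
    rw [Finset.card_product, Finset.card_univ, Finset.card_univ, Fintype.card_fin, Fintype.card_fin]
  rw [← hcard]
  refine sum_mem_swsClass _ _ fun p _ => ?_
  exact swsClass_mono (by have := hex p.1; have := hex' p.2; omega)
    (Nat.add_le_add (hex p.1) (hex' p.2))
    (affinePow_mul_affinePow_mem_swsClass (c p.1) (c' p.2) (α p.1) (α' p.2) (ex p.1) (ex' p.2))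

/-- `1 ∈ Σ∧Σ(1, 0)`. [cite: DuttaDwivediSaxena2022, §2.3 (full version p0020 L537–540)] -/
theorem one_mem_swsClass : (1 : MvPolynomial (Fin n) K) ∈ swsClass K n 1 0 := by
  have h := C_mem_swsClass (n := n) (e := 0) le_rfl (1 : K)
  rwa [C_1] at h

/-- **Lemma 2.12, `k` factors with a uniform budget**: if every `f_i ∈ Σ∧Σ(t, e)` then
`∏_{i ∈ s} f_i ∈ Σ∧Σ(t^{#s} · (#s·e + 1)^{#s}, #s · e)` (iterate the two-factor bound; the
closed form over-counts the printed `∏_{i≥2}(d_i+1) · ∏ s_i` only polynomially in the degrees).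
[cite: DuttaDwivediSaxena2022, Lemma 2.12 (full version p0020 L549–555)] -/
theorem prod_mem_swsClass [CharZero K] {ι : Type*} {t e : ℕ} (s : Finset ι)
    (f : ι → MvPolynomial (Fin n) K) (hf : ∀ i ∈ s, f i ∈ swsClass K n t e) :
    ∏ i ∈ s, f i ∈ swsClass K n (t ^ s.card * (s.card * e + 1) ^ s.card) (s.card * e) := by
  classical
  induction s using Finset.induction_on with
  | empty => simpa using one_mem_swsClass (n := n) (K := K)
  | @insert a s ha ih =>
    rw [Finset.prod_insert ha, Finset.card_insert_of_notMem ha]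
    have hfa := hf a (Finset.mem_insert_self a s)
    have hrest := ih fun i hi => hf i (Finset.mem_insert_of_mem hi)
    have hmul := mul_mem_swsClass hfa hrest
    refine swsClass_mono ?_ (by rw [Nat.succ_mul]; omega) hmul
    -- `t · (t^k (ke+1)^k) · (e + ke + 1) ≤ t^{k+1} ((k+1)e+1)^{k+1}`
    have h1 : (s.card * e + 1) ^ s.card ≤ ((s.card + 1) * e + 1) ^ s.card :=
      Nat.pow_le_pow_left (by nlinarith) _
    calc t * (t ^ s.card * (s.card * e + 1) ^ s.card) * (e + s.card * e + 1)
        = t ^ (s.card + 1) * ((s.card * e + 1) ^ s.card * ((s.card + 1) * e + 1)) := by ring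
      _ ≤ t ^ (s.card + 1) * (((s.card + 1) * e + 1) ^ s.card * ((s.card + 1) * e + 1)) :=
          Nat.mul_le_mul_left _ (Nat.mul_le_mul_right _ h1)
      _ = t ^ (s.card + 1) * ((s.card + 1) * e + 1) ^ (s.card + 1) := by ring

/-- **Powers**: `f ∈ Σ∧Σ(t, e)` ⇒ `f^k ∈ Σ∧Σ(t^k · (k·e + 1)^k, k · e)`.
[cite: DuttaDwivediSaxena2022, Lemma 2.12 (full version p0020 L549–555)] -/
theorem pow_mem_swsClass [CharZero K] {t e : ℕ} (k : ℕ) {f : MvPolynomial (Fin n) K}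
    (hf : f ∈ swsClass K n t e) :
    f ^ k ∈ swsClass K n (t ^ k * (k * e + 1) ^ k) (k * e) := by
  have h := prod_mem_swsClass (Finset.univ : Finset (Fin k)) (fun _ => f) fun _ _ => hf
  simpa using h

end Mul

/-! ## §4 Lemma 2.15: `Σ∧Σ` is closed under partial derivatives -/

section Deriv

/-- **DDS21 Lemma 2.15 (`Σ∧Σ` differentiation), with budgets**: `f ∈ Σ∧Σ(t, e)` ⇒
`∂_{x_m} f ∈ Σ∧Σ(t, e − 1)`, since `∂_{x_m} (c · ℓ^p) = (c · p · a_m) · ℓ^{p−1}` for the affine form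
`ℓ = a_∅ + ∑_j a_j x_j` (same top fan-in; the print's `O(s d²)` via Lemma 2.14 is weaker).
[cite: DuttaDwivediSaxena2022, Lemma 2.15 (full version p0021 L578–583)] -/
theorem pderiv_mem_swsClass {t e : ℕ} (m : Fin n) {f : MvPolynomial (Fin n) K}
    (hf : f ∈ swsClass K n t e) : pderiv m f ∈ swsClass K n t (e - 1) := by
  classical
  obtain ⟨c, α, ex, hex, rfl⟩ := hf
  refine mem_swsClass_of_fintype (ι := Fin t) (by simp)
    (fun i => c i * (ex i : K) * α i (some m)) α (fun i => ex i - 1)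
    (fun i => Nat.sub_le_sub_right (hex i) 1) ?_
  rw [map_sum]
  refine Finset.sum_congr rfl fun i _ => ?_
  have hℓ : pderiv m (C (α i none) + ∑ j, C (α i (some j)) * X j : MvPolynomial (Fin n) K) =
      C (α i (some m)) := by
    rw [map_add, pderiv_C, zero_add, map_sum, Finset.sum_eq_single m]
    · rw [pderiv_C_mul, pderiv_X_self, mul_one]
    · intro j _ hj
      rw [pderiv_C_mul, pderiv_X_of_ne hj, mul_zero]
    · intro hm
      exact absurd (Finset.mem_univ m) hm
  rw [pderiv_C_mul, (pderiv m).leibniz_pow, hℓ, smul_eq_mul, nsmul_eq_mul, C_mul, C_mul,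
    map_natCast]
  ring

end Deriv

/-! ## §5 Lemma 2.14: coefficient extraction in a distinguished variable -/

section Coeff

/-- Specialising the distinguished variable `x_0` of `K[x_0, …, x_n]` to a scalar `u` (the ring map
`f ↦ f(u, x_1, …, x_n)`, i.e. evaluation at `C u` of `f` viewed in `K[x_1,…,x_n][x_0]`) — the
substitution "`y ↦ α ∈ 𝔽`" of the source's interpolation.
[cite: DuttaDwivediSaxena2022, Lemma 2.14 (full version p0021 L574–576)] -/
theorem eval_C_finSuccEquiv_eq (u : K) (f : MvPolynomial (Fin (n + 1)) K) :
    Polynomial.eval (C u) (finSuccEquiv K n f) =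
      aeval (fun i : Fin (n + 1) => Fin.cases (C u) (fun j => X j) i) f := by
  -- both sides are ring maps agreeing on `C` and on the variables
  set ψ : MvPolynomial (Fin (n + 1)) K →+* MvPolynomial (Fin n) K :=
    (Polynomial.evalRingHom (C u)).comp
      (finSuccEquiv K n : MvPolynomial (Fin (n + 1)) K →+* Polynomial (MvPolynomial (Fin n) K))
    with hψ
  have hφ : (aeval (fun i : Fin (n + 1) => Fin.cases (C u) (fun j => X j) i) :
      MvPolynomial (Fin (n + 1)) K →ₐ[K] MvPolynomial (Fin n) K).toRingHom = ψ := by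
    refine ringHom_ext (fun a => ?_) (fun i => ?_)
    · rw [AlgHom.toRingHom_eq_coe, RingHom.coe_coe, aeval_C, algebraMap_eq, hψ,
        RingHom.comp_apply, finSuccEquiv_eq, eval₂Hom_C, RingHom.comp_apply,
        Polynomial.coe_evalRingHom, Polynomial.eval_C]
    · rw [AlgHom.toRingHom_eq_coe, RingHom.coe_coe, aeval_X, hψ, RingHom.comp_apply,
        Polynomial.coe_evalRingHom]
      refine Fin.cases ?_ (fun j => ?_) i
      · rw [Fin.cases_zero, RingHom.coe_coe, finSuccEquiv_X_zero, Polynomial.eval_X]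
      · rw [Fin.cases_succ, RingHom.coe_coe, finSuccEquiv_X_succ, Polynomial.eval_C]
  have := congrArg (fun φ : MvPolynomial (Fin (n + 1)) K →+* MvPolynomial (Fin n) K => φ f) hφ
  simp only [AlgHom.toRingHom_eq_coe, RingHom.coe_coe] at this
  rw [this, hψ, RingHom.comp_apply, Polynomial.coe_evalRingHom, RingHom.coe_coe]

/-- Specialising `x_0 := u` in a power of an affine form of `K[x_0, …, x_n]` gives a power of the
affine form of `K[x_1, …, x_n]` with constant term `a_∅ + u · a_0`. [folklore] -/
private theorem aeval_cases_affinePow (u : K) (a : Option (Fin (n + 1)) → K) (c : K) (p : ℕ) :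
    aeval (fun i : Fin (n + 1) => Fin.cases (C u) (fun j => X j) i)
        (C c * (C (a none) + ∑ m, C (a (some m)) * X m) ^ p : MvPolynomial (Fin (n + 1)) K) =
      C c * (C (a none + u * a (some 0)) + ∑ j : Fin n, C (a (some j.succ)) * X j) ^ p := by
  simp only [map_mul, map_pow, map_add, map_sum, aeval_C, algebraMap_eq, aeval_X]
  congr 2
  rw [Fin.sum_univ_succ, Fin.cases_zero, add_assoc]
  congr 1
  congr 1
  exact mul_comm _ _

/-- Specialising `x_0 := u` maps `Σ∧Σ(t, e)` in `n + 1` variables into `Σ∧Σ(t, e)` in `n`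
variables ("Interpolate using … points `y ↦ α ∈ 𝔽`").
[cite: DuttaDwivediSaxena2022, Lemma 2.14 (full version p0021 L574–576)] -/
theorem eval_C_finSuccEquiv_mem_swsClass {t e : ℕ} (u : K) {f : MvPolynomial (Fin (n + 1)) K}
    (hf : f ∈ swsClass K (n + 1) t e) :
    Polynomial.eval (C u) (finSuccEquiv K n f) ∈ swsClass K n t e := by
  obtain ⟨c, α, ex, hex, rfl⟩ := hf
  rw [eval_C_finSuccEquiv_eq, map_sum]
  refine mem_swsClass_of_fintype (ι := Fin t) (by simp) c
    (fun i o => Option.elim o (α i none + u * α i (some 0)) fun j => α i (some j.succ)) ex hex ?_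
  refine Finset.sum_congr rfl fun i _ => ?_
  rw [aeval_cases_affinePow]
  rfl

/-- **Lagrange extraction of one coefficient from `e + 1` values** (the interpolation step of
Lemma 2.14, stated over ANY commutative `K`-algebra `A` so that it also serves coefficient rings
such as `𝔽(ε)[z]/(z^d)` of the source's §3): for `P ∈ A[X]` of degree `≤ e`, `k ≤ e`, and the
inverse-Vandermonde row `β` of `DepthThreeChasm.exists_dual_weights e k` (nodes `0, …, e`),
`k! · coeff_k(P) = ∑_{u=0}^{e} β_u · P(u)`. [cite: DuttaDwivediSaxena2022, Lemma 2.14 (full version p0021 L574–576)] -/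
theorem factorial_mul_coeff_eq_sum_eval {A : Type*} [CommRing A] [Algebra K A] {e k : ℕ}
    (hk : k ≤ e) {β : Fin (e + 1) → K}
    (hβ : ∀ i : Fin (e + 1), ∑ u : Fin (e + 1), β u * ((u : ℕ) : K) ^ (i : ℕ) =
      if (i : ℕ) = k then ((k.factorial : ℕ) : K) else 0)
    (P : Polynomial A) (hP : P.natDegree ≤ e) :
    algebraMap K A ((k.factorial : ℕ) : K) * P.coeff k =
      ∑ u : Fin (e + 1), algebraMap K A (β u) * P.eval ((u : ℕ) : A) := by
  have hev : ∀ u : Fin (e + 1), P.eval ((u : ℕ) : A) =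
      ∑ i ∈ Finset.range (e + 1), P.coeff i * algebraMap K A (((u : ℕ) : K) ^ i) := by
    intro u
    rw [Polynomial.eval_eq_sum_range' (Nat.lt_succ_of_le hP)]
    simp only [map_pow, map_natCast]
  simp_rw [hev, Finset.mul_sum]
  rw [Finset.sum_comm]
  have hinner : ∀ i ∈ Finset.range (e + 1),
      ∑ u : Fin (e + 1), algebraMap K A (β u) * (P.coeff i * algebraMap K A (((u : ℕ) : K) ^ i)) =
        P.coeff i * algebraMap K A (∑ u : Fin (e + 1), β u * ((u : ℕ) : K) ^ i) := by
    intro i _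
    rw [map_sum, Finset.mul_sum]
    refine Finset.sum_congr rfl fun u _ => ?_
    rw [map_mul]
    ring
  rw [Finset.sum_congr rfl hinner, Finset.sum_eq_single k]
  · rw [show (∑ u : Fin (e + 1), β u * ((u : ℕ) : K) ^ k) = ((k.factorial : ℕ) : K) from by
      simpa using hβ ⟨k, Nat.lt_succ_of_le hk⟩, mul_comm]
  · intro i hi hik
    rw [show (∑ u : Fin (e + 1), β u * ((u : ℕ) : K) ^ i) = 0 from by
      simpa [hik] using hβ ⟨i, Finset.mem_range.1 hi⟩, map_zero, mul_zero]
  · intro hk'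
    exact absurd (Finset.mem_range.2 (Nat.lt_succ_of_le hk)) hk'

/-- **DDS21 Lemma 2.14 (`Σ∧Σ` coefficient extraction), with budgets**: for `f ∈ Σ∧Σ(t, e)` in the
variables `x_0, …, x_n`, every coefficient of `f` as a polynomial in `x_0` (Mathlib's
`finSuccEquiv`) lies in `Σ∧Σ((e+1) · t, e)` over `x_1, …, x_n` (print: "size `O(sd)`"):
`coef_{x_0^k} f = (k!)⁻¹ ∑_{u=0}^{e} β_u · f(u, x_1, …, x_n)` with the inverse-Vandermonde weights
of `DepthThreeChasm.exists_dual_weights` (the degree of `f` in `x_0` is at most `e`);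
characteristic zero. [cite: DuttaDwivediSaxena2022, Lemma 2.14 (full version p0021 L571–576)] -/
theorem coeff_finSuccEquiv_mem_swsClass [CharZero K] {t e : ℕ} {f : MvPolynomial (Fin (n + 1)) K}
    (hf : f ∈ swsClass K (n + 1) t e) (k : ℕ) :
    (finSuccEquiv K n f).coeff k ∈ swsClass K n ((e + 1) * t) e := by
  set P := finSuccEquiv K n f with hP
  have hdeg : P.natDegree ≤ e := by
    rw [hP, natDegree_finSuccEquiv]
    exact (degreeOf_le_totalDegree _ _).trans (totalDegree_le_of_mem_swsClass hf)
  by_cases hk : e < k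
  · rw [Polynomial.coeff_eq_zero_of_natDegree_lt (hdeg.trans_lt hk)]
    exact zero_mem_swsClass _ _
  rw [not_lt] at hk
  obtain ⟨β, hβ⟩ := DepthThreeChasm.exists_dual_weights (K := K) e k
  -- Lagrange extraction: `k! · p_k = ∑_u β_u P(u)`
  have hkey := factorial_mul_coeff_eq_sum_eval (A := MvPolynomial (Fin n) K) hk hβ P hdeg
  rw [algebraMap_eq] at hkey
  have hfact : ((k.factorial : ℕ) : K) ≠ 0 := by exact_mod_cast (Nat.factorial_pos k).ne'
  have hcoeff : P.coeff k = C (((k.factorial : ℕ) : K)⁻¹) *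
      ∑ u : Fin (e + 1), C (β u) * Polynomial.eval (((u : ℕ) : MvPolynomial (Fin n) K)) P := by
    rw [← hkey, ← mul_assoc, ← C_mul, inv_mul_cancel₀ hfact, C_1, one_mul]
  rw [hcoeff]
  refine C_mul_mem_swsClass _ ?_
  have h := sum_univ_mem_swsClass (K := K) (n := n) (t := t) (e := e)
    (fun u : Fin (e + 1) => C (β u) * Polynomial.eval (((u : ℕ) : MvPolynomial (Fin n) K)) P)
    fun u => C_mul_mem_swsClass _ (by
      rw [← map_natCast (C : K →+* MvPolynomial (Fin n) K)]
      exact eval_C_finSuccEquiv_mem_swsClass _ hf)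
  rwa [Fintype.card_fin] at h

end Coeff

/-! ## §6 Lemma 2.17 for `Σ∧Σ`: sums of products of univariates (Saxena's duality trick) -/

section Duality

/-- A univariate polynomial in the variable `x_m` involves only `x_m` (the "univariate polynomials as
edge labels" of DDS Def. 2.5). [cite: DuttaDwivediSaxena2022, Def. 2.5 (full version p0017 L468 – p0018 L476)] -/
theorem vars_aeval_X_subset (m : Fin n) (q : Polynomial K) :
    (Polynomial.aeval (X m : MvPolynomial (Fin n) K) q).vars ⊆ {m} := by
  classical
  rw [Polynomial.aeval_eq_sum_range]
  refine (vars_sum_subset _ _).trans (Finset.biUnion_subset.2 fun i _ => ?_)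
  rw [smul_eq_C_mul]
  refine (vars_mul _ _).trans (Finset.union_subset (by rw [vars_C]; exact Finset.empty_subset _) ?_)
  exact (vars_pow _ _).trans (by rw [vars_X])

/-- A univariate polynomial of degree `≤ e` in the variable `x_m` has total degree `≤ e` (label
degree bookkeeping of DDS Def. 2.5). [cite: DuttaDwivediSaxena2022, Def. 2.5 (full version p0017 L468 – p0018 L476)] -/
theorem totalDegree_aeval_X_le (m : Fin n) {q : Polynomial K} {e : ℕ} (hq : q.natDegree ≤ e) :
    (Polynomial.aeval (X m : MvPolynomial (Fin n) K) q).totalDegree ≤ e := by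
  rw [Polynomial.aeval_eq_sum_range]
  refine totalDegree_finsetSum_le fun i hi => (totalDegree_smul_le _ _).trans ?_
  rw [totalDegree_X_pow]
  exact (Nat.le_of_lt_succ (Finset.mem_range.1 hi)).trans hq

/-- **DDS21 Lemma 2.17 for `Σ∧Σ` (sum of products of univariates), with budgets.** Over a field of
characteristic zero, every `f ∈ Σ∧Σ(t, e)` in `x_0, …, x_{n-1}` is a sum of `t · ((n+1)·e + 1)`
terms `κ · ∏_{m<n} g_m(x_m)` with univariate `g_m` of degree `≤ e`: each power
`ℓ^{p} = (a_∅ + ∑_m a_m x_m)^p` is, by Saxena's duality trick (the source's Lemma 2.16; tree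
`DepthThreeChasm.duality` with the `n + 1` summands `a_∅, a_m x_m`, `W = p`, nodes `0, …, (n+1)e`),
`∑_u β_u · E_p(u a_∅) · ∏_m E_p(u a_m x_m)` with the truncated exponentials
`E_p(w) = ∑_{j ≤ p} w^j / j!` (print: "`g^e = ∑_{i=1}^{O(ne)} h_{i1}(x_1) ⋯ h_{in}(x_n)`, where each
`h_{ij}` is of degree at most `D` … top fan-in `O(sne)`").
[cite: DuttaDwivediSaxena2022, Lemma 2.16 and Lemma 2.17 (full version p0022 L586–603)] -/
theorem exists_sum_prod_univariate_of_mem_swsClass [CharZero K] {t e : ℕ}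
    {f : MvPolynomial (Fin n) K} (hf : f ∈ swsClass K n t e) :
    ∃ (κ : Fin t × Fin ((n + 1) * e + 1) → K)
      (g : Fin t × Fin ((n + 1) * e + 1) → Fin n → Polynomial K),
      (∀ p m, (g p m).natDegree ≤ e) ∧
        f = ∑ p, C (κ p) * ∏ m, Polynomial.aeval (X m : MvPolynomial (Fin n) K) (g p m) := by
  classical
  obtain ⟨c, α, ex, hex, rfl⟩ := hf
  set N : ℕ := (n + 1) * e with hN
  choose β hβ using fun i : Fin t => DepthThreeChasm.exists_dual_weights (K := K) N (ex i)
  -- the constants `E_{p_i}(u · a_∅)` and the univariates `E_{p_i}(u · a_m · X)`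
  let κ0 : Fin t → Fin (N + 1) → K := fun i u =>
    ∑ j ∈ Finset.range (ex i + 1), ((j.factorial : ℕ) : K)⁻¹ * ((u : ℕ) : K) ^ j * α i none ^ j
  let g : Fin t × Fin (N + 1) → Fin n → Polynomial K := fun p m =>
    ∑ j ∈ Finset.range (ex p.1 + 1),
      Polynomial.C ((((j.factorial : ℕ) : K)⁻¹) * ((p.2 : ℕ) : K) ^ j * α p.1 (some m) ^ j) *
        Polynomial.X ^ (1 * j)
  refine ⟨fun p => c p.1 * β p.1 p.2 * κ0 p.1 p.2, g, fun p m => ?_, ?_⟩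
  · exact (DepthThreeChasm.natDegree_truncExp_le (ex p.1) 1 ((p.2 : ℕ) : K) (α p.1 (some m))).trans
      (by rw [one_mul]; exact hex p.1)
  · rw [Fintype.sum_prod_type]
    refine Finset.sum_congr rfl fun i _ => ?_
    -- Saxena's duality for the `n + 1` summands of the affine form `ℓ_i`
    let y : Option (Fin n) → MvPolynomial (Fin n) K := fun v =>
      Option.elim v (C (α i none)) fun m => algebraMap K (MvPolynomial (Fin n) K) (α i (some m)) * X m ^ 1
    have hcard : Fintype.card (Option (Fin n)) * ex i ≤ N := by
      rw [Fintype.card_option, Fintype.card_fin, hN]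
      exact Nat.mul_le_mul_left _ (hex i)
    have hdual := DepthThreeChasm.duality (R := MvPolynomial (Fin n) K) hcard (hβ i) y
    have hsum : ∑ v, y v = C (α i none) + ∑ m, C (α i (some m)) * X m := by
      rw [Fintype.sum_option]
      simp only [y, Option.elim, algebraMap_eq, pow_one]
    rw [← hsum, ← hdual, Finset.mul_sum]
    refine Finset.sum_congr rfl fun u _ => ?_
    rw [Fintype.prod_option]
    have hnone : (∑ j ∈ Finset.range (ex i + 1),
        algebraMap K (MvPolynomial (Fin n) K) ((((j.factorial : ℕ) : K)⁻¹) * ((u : ℕ) : K) ^ j) *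
          y none ^ j) = C (κ0 i u) := by
      simp only [y, Option.elim, κ0, map_sum, C_mul, C_pow, algebraMap_eq]
    have hsome : ∀ m : Fin n, (∑ j ∈ Finset.range (ex i + 1),
        algebraMap K (MvPolynomial (Fin n) K) ((((j.factorial : ℕ) : K)⁻¹) * ((u : ℕ) : K) ^ j) *
          y (some m) ^ j) = Polynomial.aeval (X m : MvPolynomial (Fin n) K) (g (i, u) m) := by
      intro m
      simp only [y, Option.elim, g]
      exact DepthThreeChasm.truncExp_eq_aeval (ex i) 1 ((u : ℕ) : K) (α i (some m)) (X m)
    rw [hnone, Finset.prod_congr rfl fun m _ => hsome m, algebraMap_eq, C_mul, C_mul]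
    ring

end Duality


end DDS2021

end Literature.Computability.AlgebraicComplexity

end
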